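import Summits.ABC.ABC.Theses.IsogenyGlueCongruence
import Summits.ABC.ABC.Theorems.IsogenyGlueCongruenceSemistableHeightPolyBoundModular
import Literature.NumberTheory.EllipticCurves.PeriodRelationsProofs
import HarnessLib

/-!
# Route `IsogenyGlueCongruence`, support item `SemistableHeightPolyBoundOfMazurKenku`

Item `stmt-ABC-15128` of route `ABC/IsogenyGlueCongruence`:
`MazurKenkuBound → ModularDatumExists → SemistableHeightPolyBound` — the crude height bound
`h_F(W) ≤ c · N²` of the U-line (`SemistableHeightPolyBound`, item `stmt-ABC-13918`) derived from the
two rank-9 formal-debt cruxes `MazurKenkuBound` (item `stmt-ABC-15125`) and `ModularDatumExists`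
(item `stmt-ABC-15126`).

The whole deduction is the landed classical modular approach
`Summit.ABC.ABC.Theorems.semistableHeightPolyBound_of_modularity_of_mazurKenku_of_thm_5_5`
(`IsogenyGlueCongruenceSemistableHeightPolyBoundModular.lean`: `h(E) ≤ ½ N log N + 9` for `N ≫ 1`
via the class-minimal datum, Mazur–Kenku and Pasten's Thm 5.5, Shafarevich finiteness below the
threshold), whose three named-fact hypotheses are met as follows:

* `nonempty_modularParametrizationData` is DEFINITIONALLY the route item `ModularDatumExists`;
* `PastenShimura2024_minimalDegree_le_163_mul` is DEFINITIONALLY the route item `MazurKenkuBound`;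
* `PastenShimura2024_thm_5_5` is a THEOREM of the tree,
  `Literature.NumberTheory.EllipticCurves.ModularForms.PastenShimura2024_thm_5_5_holds`
  (`Literature/NumberTheory/EllipticCurves/PeriodRelationsProofs.lean`).

So the item holds unconditionally (no named-fact hypothesis remains).

## References

* [PastenShimura2024] H. Pasten, *Shimura curves and the abc conjecture*, J. Number Theory 254
  (2024) 214–335: §3 p. 13, Thm 5.5, Thm 7.2.
* [MurtyPasten2013] M. R. Murty, H. Pasten, *Modular forms and effective Diophantine
  approximation*, J. Number Theory 133 (2013) 3739–3754, Thm 1.1.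
-/

noncomputable section

-- `Summit.<Summit>.<Problem>` is the mandated summit-side namespace (CONVENTIONS §2); for the
-- single-conjunct summit `ABC` the two coincide, so the duplicate `ABC.ABC` is deliberate.
set_option linter.dupNamespace false

namespace Summit.ABC.ABC.Theorems

open Literature.NumberTheory.EllipticCurves.ModularForms

/-- **Item `SemistableHeightPolyBoundOfMazurKenku` (stmt-ABC-15128), proved.**
`MazurKenkuBound → ModularDatumExists → SemistableHeightPolyBound`: given the Mazur–Kenku comparison
of modular degrees inside an isogeny class (`MazurKenkuBound`, definitionally the Literature fact
`PastenShimura2024_minimalDegree_le_163_mul`) and modularity with an integral Manin constant in datum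
form (`ModularDatumExists`, definitionally `nonempty_modularParametrizationData`), there is an
absolute `c` with `h_F(W) ≤ c · (W.conductorNorm ℤ)²` for every semistable elliptic `W/ℚ` given by a
globally minimal model. One line over the landed
`semistableHeightPolyBound_of_modularity_of_mazurKenku_of_thm_5_5`, its third input (Pasten's
Thm 5.5) being the tree theorem `PastenShimura2024_thm_5_5_holds`. Unconditional.
[cite: PastenShimura2024, §3 p. 13, Thm. 5.5, Thm. 7.2] [cite: MurtyPasten2013, Thm 1.1] -/
theorem semistableHeightPolyBoundOfMazurKenku_proof :
    Summit.ABC.ABC.Theses.IsogenyGlueCongruence.SemistableHeightPolyBoundOfMazurKenku := by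
  unfold Summit.ABC.ABC.Theses.IsogenyGlueCongruence.SemistableHeightPolyBoundOfMazurKenku
  intro hMK hmod
  exact semistableHeightPolyBound_of_modularity_of_mazurKenku_of_thm_5_5 hmod hMK
    PastenShimura2024_thm_5_5_holds

end Summit.ABC.ABC.Theorems

end
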